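import Summits.QuantumAdvantage.AdviceFreeQNC0.LiftCost
import Literature.Computability.MetaComplexity.HypercubeSchwartzZippel
import HarnessLib

/-!
# Cell qa-qnc0 (rung F-S1, route RingFrame, crux α, line `tensor`): the mean-load lemma for strictly
# light syndrome systems (qn-p2 ROUND-4 LEMMA 2.1, ask T-b `AvgLoad`)

Planner qa-qnc0-p2's `line/Sketch4.lean` §2 types, in the vocabulary of `UnionBoundLift.lean`
(p464335: `LinCols`, `RowsDeg`, `rowDist`, `hw`, `xorM`), asks about STRICTLY LIGHT syndrome systems
(`StrictSys d w X Y`: `2w < f := 2^{L'−d}`, `X` has linear columns, the rows of `Y` lie in `RM(d, L')`,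
every coset leader `a_u = X(u,·) + Y(u,·)` has weight `≤ w`).  This file proves

* **T-b, LEMMA 2.1 (mean load)** `avgLoad : AvgLoad` — if the leader system is NON-ADDITIVE (some
  cocycle value `Φ(u,u') = a_u + a_{u'} + a_{u+u'}` is non-zero) then the total leader weight
  `T = Σ_u |a_u|` satisfies `2^{L−1}·f ≤ 3T`.

Proof (ROUND-4 §2): the columns of `X` are linear, so `Φ(u,u') = Y(u) + Y(u') + Y(u+u') ∈ RM(d,L')`
(`phi_eq`, `hasDeg_phi`); a non-zero one has weight `≥ f` (Reed–Muller minimum distance =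
`Smolensky.two_pow_le_card_support`, `two_pow_le_card_filter_of_hasDeg`), and `|Φ| ≤ |a_u| + |a_{u'}|
+ |a_{u+u'}|` (`card_phi_le`), so one of the three leaders weighs `≥ f/3` (`exists_heavy_leader`); call
it `a_{x₀}`; `x₀ ≠ 0` because `a_0 = 0` (`rowDist_zero`: a non-zero `Y(0,·) ∈ RM(d)` would weigh
`≥ f > w`).  For every `y` the pair `{y, y + x₀}` carries weight `≥ f/3` (`pair_load`: if `Φ(y,x₀) = 0`
then `a_{x₀} = a_y + a_{y+x₀}` pointwise, else `|a_y| + w + |a_{y+x₀}| ≥ |Φ(y,x₀)| ≥ f` with `2w < f`);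
summing over `y` along the involution `y ↦ y + x₀` (`sum_comp_bx`) gives `6T ≥ 2^L·f`.

Statement `AvgLoad` and the auxiliary vocabulary `bx`, `ldr`, `phi`, `StrictSys`, `NonAdditive` are
VERBATIM from `Sketch4.lean` (vocabulary in the sub-namespace `MeanLoad`; shape check `Iff.rfl` against
the planner's file, farm rc 0).  Sequel `CovLogSuffices.lean`: T-c, `LiftOneStrictLog → LiftOneLogStrict`.
WHAT THIS IS NOT: `AvgLoad` is "true but off-path" after `S1-REFUTED.md` (it is the input of T-c);
nothing here on S1′ / R1 / `TRPlus` / α or the separation. [folklore]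
-/

namespace Summit.QuantumAdvantage.AdviceFreeQNC0

open Finset
open Literature.Computability.MetaComplexity Literature.Computability.MetaComplexity.Smolensky

/-! ### Vocabulary (verbatim from qn-p2 `line/Sketch4.lean`) -/

namespace MeanLoad

/-- pointwise sum of two row indices `u + u'` in `𝔽₂^L`. -/
def bx {L : ℕ} (u u' : Fin L → Bool) : Fin L → Bool := fun i => xor (u i) (u' i)

/-- the leader matrix `a_u(v) = X(u,v) + Y(u,v)`. -/
def ldr {L L' : ℕ} (X Y : (Fin L → Bool) → (Fin L' → Bool) → Bool) (u : Fin L → Bool)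
    (v : Fin L' → Bool) : Bool := xor (X u v) (Y u v)

/-- `v ∈ Φ(u,u')` : the cocycle `Φ(u,u') = a_u + a_{u'} + a_{u+u'}` evaluated at `v`. -/
def phi {L L' : ℕ} (X Y : (Fin L → Bool) → (Fin L' → Bool) → Bool) (u u' : Fin L → Bool)
    (v : Fin L' → Bool) : Bool := xor (ldr X Y u v) (xor (ldr X Y u' v) (ldr X Y (bx u u') v))

/-- the hypotheses "strictly light system of order `d` and radius `w`" bundled. -/
def StrictSys {L L' : ℕ} (d w : ℕ) (X Y : (Fin L → Bool) → (Fin L' → Bool) → Bool) : Prop :=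
  2 * w < 2 ^ (L' - d) ∧ LinCols X ∧ RowsDeg d Y ∧ ∀ u, rowDist X Y u ≤ w

/-- "non-additive": the leader matrix is not itself column-linear (some cocycle value `Φ ≠ 0`). -/
def NonAdditive {L L' : ℕ} (X Y : (Fin L → Bool) → (Fin L' → Bool) → Bool) : Prop :=
  ∃ u u' v, phi X Y u u' v = true

/-! ### `𝔽₂`-indicators of Booleans -/

/-- the indicator of `a ⊕ b` is the sum of the indicators. [folklore] -/
theorem ind_xor (a b : Bool) :
    (if (xor a b) = true then (1 : ZMod 2) else 0) =
      (if a = true then (1 : ZMod 2) else 0) + (if b = true then (1 : ZMod 2) else 0) := by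
  revert a b; decide

/-- the indicator is injective. [folklore] -/
theorem eq_of_ind_eq :
    ∀ a b : Bool, (if a = true then (1 : ZMod 2) else 0) = (if b = true then (1 : ZMod 2) else 0) →
      a = b := by
  decide

/-- the indicator is non-zero exactly at `true`. [folklore] -/
theorem ind_ne_zero_iff (a : Bool) : (if a = true then (1 : ZMod 2) else 0) ≠ 0 ↔ a = true := by
  revert a; decide

end MeanLoad

open MeanLoad

/-- **T-b (qn-p2 ROUND-4 LEMMA 2.1, mean load; `Sketch4.AvgLoad` verbatim)**: in a non-additive
strictly light system the total leader weight `T` satisfies `2^{L-1}·2^{L'-d} ≤ 3·T`. -/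
def AvgLoad : Prop :=
  ∀ (L L' d w : ℕ) (X Y : (Fin L → Bool) → (Fin L' → Bool) → Bool), StrictSys d w X Y →
    NonAdditive X Y → 2 ^ (L - 1) * 2 ^ (L' - d) ≤ 3 * univ.sum fun u => rowDist X Y u

section

variable {L L' : ℕ}

/-! ### Linear columns: `X(u + u') = X(u) + X(u')`, hence `Φ(u,u') = Y u + Y u' + Y (u+u')` -/

/-- A matrix with linear columns is additive in the row index. [folklore] -/
theorem apply_bx_of_linCols {X : (Fin L → Bool) → (Fin L' → Bool) → Bool} (hX : LinCols X)
    (u u' : Fin L → Bool) (v : Fin L' → Bool) : X (bx u u') v = xor (X u v) (X u' v) := by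
  apply eq_of_ind_eq
  rw [ind_xor, apply_eq_sum_basis_of_linCols hX (bx u u') v, apply_eq_sum_basis_of_linCols hX u v,
    apply_eq_sum_basis_of_linCols hX u' v, ← Finset.sum_add_distrib]
  refine Finset.sum_congr rfl fun i _ => ?_
  rw [← add_mul]
  congr 1
  exact ind_xor (u i) (u' i)

/-- **The cocycle is a sum of three rows of `Y`**: `Φ(u,u')(v) = Y u v + Y u' v + Y (u+u') v`
(the `X`-parts cancel because the columns of `X` are linear). -/
theorem phi_eq {X Y : (Fin L → Bool) → (Fin L' → Bool) → Bool} (hX : LinCols X)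
    (u u' : Fin L → Bool) (v : Fin L' → Bool) :
    phi X Y u u' v = xor (Y u v) (xor (Y u' v) (Y (bx u u') v)) := by
  have key : ∀ a b y₁ y₂ y₃ : Bool,
      xor (xor a y₁) (xor (xor b y₂) (xor (xor a b) y₃)) = xor y₁ (xor y₂ y₃) := by decide
  unfold phi ldr
  rw [apply_bx_of_linCols hX u u' v]
  exact key _ _ _ _ _

/-- The cocycle `Φ(u,u')` has `𝔽₂`-degree `≤ d`. -/
theorem hasDeg_phi {d : ℕ} {X Y : (Fin L → Bool) → (Fin L' → Bool) → Bool} (hX : LinCols X)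
    (hY : RowsDeg d Y) (u u' : Fin L → Bool) : HasDeg (phi X Y u u') d := by
  have h : phi X Y u u' = fun v => xor (Y u v) (xor (Y u' v) (Y (bx u u') v)) :=
    funext fun v => phi_eq hX u u' v
  rw [h]
  exact hasDeg_xor (hY u) (hasDeg_xor (hY u') (hY (bx u u')))

/-! ### Reed–Muller minimum distance: a non-zero degree-`d` Boolean function has `≥ 2^{L'-d}` ones -/

/-- A Boolean function of degree `≤ d` on `{0,1}^{L'}` which is not identically `false` is `true` at
`≥ 2^{L'−d}` points (`Smolensky.two_pow_le_card_support`). [folklore] -/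
theorem two_pow_le_card_filter_of_hasDeg {d : ℕ} {g : (Fin L' → Bool) → Bool} (hg : HasDeg g d)
    (hne : ∃ v, g v = true) :
    2 ^ (L' - d) ≤ (univ.filter fun v : Fin L' → Bool => g v = true).card := by
  obtain ⟨v₀, hv₀⟩ := hne
  have hP : (fun v => if g v = true then (1 : ZMod 2) else 0) ≠ 0 := by
    intro h
    have h0 := congrFun h v₀
    simp only [hv₀, if_true, Pi.zero_apply] at h0
    exact one_ne_zero h0
  refine (two_pow_le_card_support hg hP).trans (le_of_eq ?_)
  congr 1
  exact Finset.filter_congr fun v _ => ind_ne_zero_iff (g v)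

/-! ### Leader weights -/

/-- `rowDist X Y u = |a_u|` (the number of `v` with `ldr X Y u v = true`). -/
theorem rowDist_eq_card_ldr (X Y : (Fin L → Bool) → (Fin L' → Bool) → Bool) (u : Fin L → Bool) :
    rowDist X Y u = (univ.filter fun v : Fin L' → Bool => ldr X Y u v = true).card := by
  unfold rowDist ldr
  congr 1
  have key : ∀ a b : Bool, xor a b = true ↔ a ≠ b := by decide
  exact Finset.filter_congr fun v _ => (key (X u v) (Y u v)).symm

/-- **Subadditivity**: `|Φ(u,u')| ≤ |a_u| + |a_{u'}| + |a_{u+u'}|`. -/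
theorem card_phi_le {X Y : (Fin L → Bool) → (Fin L' → Bool) → Bool} (u u' : Fin L → Bool) :
    (univ.filter fun v : Fin L' → Bool => phi X Y u u' v = true).card ≤
      rowDist X Y u + rowDist X Y u' + rowDist X Y (bx u u') := by
  rw [rowDist_eq_card_ldr, rowDist_eq_card_ldr, rowDist_eq_card_ldr]
  refine le_trans (Finset.card_le_card ?_)
    ((Finset.card_union_le _ _).trans (Nat.add_le_add_right (Finset.card_union_le _ _) _))
  intro v hv
  rw [Finset.mem_filter] at hv
  have key : ∀ a b c : Bool, xor a (xor b c) = true → a = true ∨ b = true ∨ c = true := by decide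
  rcases key _ _ _ hv.2 with h | h | h
  · exact Finset.mem_union_left _ (Finset.mem_union_left _ (Finset.mem_filter.2 ⟨mem_univ _, h⟩))
  · exact Finset.mem_union_left _ (Finset.mem_union_right _ (Finset.mem_filter.2 ⟨mem_univ _, h⟩))
  · exact Finset.mem_union_right _ (Finset.mem_filter.2 ⟨mem_univ _, h⟩)

/-- In a strictly light system the zero row carries no load: `a_0 = 0` (a non-zero `Y(0,·) ∈ RM(d)`
would weigh `≥ f > w`). -/
theorem rowDist_zero {d w : ℕ} {X Y : (Fin L → Bool) → (Fin L' → Bool) → Bool}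
    (hS : StrictSys d w X Y) : rowDist X Y (fun _ => false) = 0 := by
  obtain ⟨hw2, hX, hY, hle⟩ := hS
  have hcol : ∀ v, ldr X Y (fun _ => false) v = Y (fun _ => false) v := by
    intro v; unfold ldr; rw [hX.2 v]; exact Bool.false_xor _
  by_contra hne
  have hex : ∃ v, Y (fun _ => false) v = true := by
    by_contra hall
    push Not at hall
    apply hne
    rw [rowDist_eq_card_ldr, Finset.card_eq_zero, Finset.filter_eq_empty_iff]
    intro v _
    rw [hcol v]
    exact fun h => hall v h
  have hge := two_pow_le_card_filter_of_hasDeg (hY (fun _ => false)) hex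
  have heq : (univ.filter fun v : Fin L' → Bool => Y (fun _ => false) v = true).card =
      rowDist X Y (fun _ => false) := by
    rw [rowDist_eq_card_ldr]
    exact congrArg Finset.card (Finset.filter_congr fun v _ => by rw [hcol v])
  have := hle (fun _ => false)
  omega

/-- **Some leader is heavy**: in a non-additive strictly light system some `a_{x₀}` has
`3·|a_{x₀}| ≥ f`. -/
theorem exists_heavy_leader {d w : ℕ} {X Y : (Fin L → Bool) → (Fin L' → Bool) → Bool}
    (hS : StrictSys d w X Y) (hN : NonAdditive X Y) :
    ∃ x₀ : Fin L → Bool, 2 ^ (L' - d) ≤ 3 * rowDist X Y x₀ := by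
  obtain ⟨u, u', v, hv⟩ := hN
  have hge := two_pow_le_card_filter_of_hasDeg (hasDeg_phi hS.2.1 hS.2.2.1 u u') ⟨v, hv⟩
  have hle := card_phi_le (X := X) (Y := Y) u u'
  by_contra h
  push Not at h
  have h1 := h u
  have h2 := h u'
  have h3 := h (bx u u')
  omega

/-- **Pairing**: if `3·|a_{x₀}| ≥ f` then every pair `{y, y + x₀}` carries `3·(|a_y| + |a_{y+x₀}|) ≥ f`. -/
theorem pair_load {d w : ℕ} {X Y : (Fin L → Bool) → (Fin L' → Bool) → Bool}
    (hS : StrictSys d w X Y) {x₀ : Fin L → Bool} (hx₀ : 2 ^ (L' - d) ≤ 3 * rowDist X Y x₀)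
    (y : Fin L → Bool) :
    2 ^ (L' - d) ≤ 3 * (rowDist X Y y + rowDist X Y (bx y x₀)) := by
  obtain ⟨hw2, hX, hY, hle⟩ := hS
  by_cases hne : ∃ v, phi X Y y x₀ v = true
  · -- `Φ(y,x₀) ≠ 0`: weight `≥ f`, and `|Φ| ≤ |a_y| + |a_{x₀}| + |a_{y+x₀}| ≤ |a_y| + w + |a_{y+x₀}|`
    have hge := two_pow_le_card_filter_of_hasDeg (hasDeg_phi hX hY y x₀) hne
    have hsub := card_phi_le (X := X) (Y := Y) y x₀
    have hwx := hle x₀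
    omega
  · -- `Φ(y,x₀) = 0`: `a_{x₀} = a_y + a_{y+x₀}` pointwise, so `|a_{x₀}| ≤ |a_y| + |a_{y+x₀}|`
    push Not at hne
    have hpt : ∀ v, ldr X Y x₀ v = xor (ldr X Y y v) (ldr X Y (bx y x₀) v) := by
      intro v
      have h := hne v
      have key : ∀ a b c : Bool, xor a (xor b c) ≠ true → b = xor a c := by decide
      exact key _ _ _ (by simpa [phi] using h)
    have hsub : rowDist X Y x₀ ≤ rowDist X Y y + rowDist X Y (bx y x₀) := by
      rw [rowDist_eq_card_ldr, rowDist_eq_card_ldr, rowDist_eq_card_ldr]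
      refine (Finset.card_le_card ?_).trans (Finset.card_union_le _ _)
      intro v hv
      rw [Finset.mem_filter] at hv
      rw [Finset.mem_union, Finset.mem_filter, Finset.mem_filter]
      have key : ∀ b c : Bool, xor b c = true → b = true ∨ c = true := by decide
      rcases key _ _ (by rw [← hpt v]; exact hv.2) with h | h
      · exact Or.inl ⟨mem_univ _, h⟩
      · exact Or.inr ⟨mem_univ _, h⟩
    omega

/-- `y ↦ y + x₀` is an involution of `𝔽₂^L`. [folklore] -/
theorem bx_bx_self (y x₀ : Fin L → Bool) : bx (bx y x₀) x₀ = y := by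
  funext i
  unfold bx
  cases y i <;> cases x₀ i <;> rfl

/-- Summing a function over the translate `y ↦ y + x₀` does not change the sum. [folklore] -/
theorem sum_comp_bx (x₀ : Fin L → Bool) (F : (Fin L → Bool) → ℕ) :
    ∑ y, F (bx y x₀) = ∑ y, F y := by
  let e : (Fin L → Bool) ≃ (Fin L → Bool) :=
    ⟨fun y => bx y x₀, fun y => bx y x₀, fun y => bx_bx_self y x₀, fun y => bx_bx_self y x₀⟩
  exact Equiv.sum_comp e F

/-- `#𝔽₂^L = 2^L`. [folklore] -/
theorem card_rows : Fintype.card (Fin L → Bool) = 2 ^ L := by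
  rw [Fintype.card_fun, Fintype.card_bool, Fintype.card_fin]

/-! ### T-b: the mean-load lemma -/

/-- **`avgLoad : AvgLoad`** (qn-p2 ROUND-4 LEMMA 2.1). -/
theorem avgLoad : AvgLoad := by
  intro L L' d w X Y hS hN
  obtain ⟨x₀, hx₀⟩ := exists_heavy_leader hS hN
  -- `x₀ ≠ 0`, hence `L ≥ 1`
  have hx₀ne : x₀ ≠ fun _ => false := by
    rintro rfl
    rw [rowDist_zero hS, mul_zero] at hx₀
    have : 0 < 2 ^ (L' - d) := Nat.two_pow_pos _
    omega
  have hL : 0 < L := by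
    by_contra hL
    push Not at hL
    have hL0 : L = 0 := Nat.le_zero.1 hL
    subst hL0
    exact hx₀ne (funext fun i => Fin.elim0 i)
  -- sum the pair inequality over `y`
  have hsum : ∑ _y : Fin L → Bool, 2 ^ (L' - d) ≤
      ∑ y : Fin L → Bool, 3 * (rowDist X Y y + rowDist X Y (bx y x₀)) :=
    Finset.sum_le_sum fun y _ => pair_load hS hx₀ y
  rw [Finset.sum_const, Finset.card_univ, card_rows, smul_eq_mul, ← Finset.mul_sum,
    Finset.sum_add_distrib, sum_comp_bx x₀ (fun y => rowDist X Y y)] at hsum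
  -- `2^L·f ≤ 3·(T + T)`, i.e. `2·2^{L-1}·f ≤ 6T`
  have hpow : 2 ^ L = 2 * 2 ^ (L - 1) := by
    rw [← Nat.pow_succ']
    congr 1
    omega
  rw [hpow] at hsum
  have : 2 * (2 ^ (L - 1) * 2 ^ (L' - d)) ≤ 2 * (3 * ∑ y : Fin L → Bool, rowDist X Y y) := by
    calc 2 * (2 ^ (L - 1) * 2 ^ (L' - d)) = 2 * 2 ^ (L - 1) * 2 ^ (L' - d) := by ring
      _ ≤ 3 * (∑ y : Fin L → Bool, rowDist X Y y + ∑ y : Fin L → Bool, rowDist X Y y) := hsum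
      _ = 2 * (3 * ∑ y : Fin L → Bool, rowDist X Y y) := by ring
  exact Nat.le_of_mul_le_mul_left this (by norm_num)


end

end Summit.QuantumAdvantage.AdviceFreeQNC0
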